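import Literature.Probability.RandomPlanarGeometry.SLEThrPieceMartingales
import Literature.Probability.Process.StoppedIncrementPullOut
import HarnessLib

/-!
# The through-swallow image chain of SLE₆: the level-`n` approximations are a.e. martingales

Sequel of `SLEThrPieceMartingales` (Lawler–Schramm–Werner (2001) Thm. 2.2 / G. F. Lawler (2005) §6.3
Thm. 6.13: gluing of the image driving martingales through the swallow instants). Theorems only:

* `IsAEMartingale.finset_sum`, `uniformIntegrable_of_abs_le` — generic helpers;
* `isAEMartingale_pieceIncr`, `isAEMartingale_thrLevelSum` — the level-`n` piece increments
  `M^{s,n}_{t ∧ σ_s} − M^{s,n}_{t ∧ ρ_s}` and their sum over the pieces are a.e. martingales (optional stopping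
  of the continuous piece martingales at the stopping times `ρ_s ≤ σ_s`);
* `measurable_stoppedValue_thrLevelSum`, `abs_stoppedProcess_pieceMart_le`, `stoppedProcess_pieceClock_mem`,
  `abs_thrLevelSum_le` — the sum read at `ρ_s` is `𝓕_{ρ_s}`-measurable; uniform bounds before the horizon;
* `isAEMartingale_thrLevelBracket`, `abs_thrLevelBracket_le` — the level-`n` compensated square
  `∑_s ((G_s)² − 6 ΔC_s + 2 U_{ρ_s} G_s)` is a uniformly bounded a.e. martingale: each summand is
  `(R^{σ_s} − R^{ρ_s}) + ξ_s (M^{σ_s} − M^{ρ_s})` with `R = M² − 6 · pieceClock` a continuous martingale and the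
  bounded `𝓕_{ρ_s}`-measurable weight `ξ_s = 2 U_{ρ_s} − 2 M_{ρ_s}` pulled out of the stopped increment
  (`Process.isAEMartingale_mul_stoppedProcess_sub`).

## References

* G. F. Lawler, O. Schramm, W. Werner, Acta Math. **187** (2001), Thm. 2.2. [LawlerSchrammWerner2001]
* G. F. Lawler (2005), §6.3 Thm. 6.13. [Lawler2005]
* J.-F. Le Gall (2016), Prop. 4.7, Cor. 3.23. [Legall2016]
-/

noncomputable section

open Set Filter Metric Function MeasureTheory
open _root_.Complex _root_.Topology
open scoped NNReal

namespace Literature.Probability.RandomPlanarGeometry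

open Loewner Literature.Probability.Process

/-! ### Generic helpers -/

/-- Finite sums of a.e. martingales are a.e. martingales. [folklore] -/
theorem _root_.Literature.Probability.Process.IsAEMartingale.finset_sum {Ω ι : Type*} {m : MeasurableSpace Ω}
    {𝓕 : Filtration ℝ≥0 m} {P : Measure Ω} [IsFiniteMeasure P] {I : Finset ι} {M : ι → ℝ≥0 → Ω → ℝ}
    (h : ∀ i ∈ I, IsAEMartingale (M i) 𝓕 P) : IsAEMartingale (fun t ω ↦ ∑ i ∈ I, M i t ω) 𝓕 P := by
  classical
  induction I using Finset.induction_on with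
  | empty =>
    simp only [Finset.sum_empty]
    exact ⟨fun t ↦ aestronglyMeasurable_const, fun r t _ ↦ (condExp_const (𝓕.le r) (0 : ℝ)).eventuallyEq⟩
  | insert a I ha ih =>
    simp only [Finset.sum_insert ha]
    exact (h a (Finset.mem_insert_self a I)).add (ih fun i hi ↦ h i (Finset.mem_insert_of_mem hi))

/-- A uniformly bounded sequence of a.e. strongly measurable real functions on a finite measure space is
uniformly integrable. [folklore] -/
theorem uniformIntegrable_of_abs_le {Ω : Type*} [MeasurableSpace Ω] {μ : Measure Ω} [IsFiniteMeasure μ]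
    {f : ℕ → Ω → ℝ} (hf : ∀ n, AEStronglyMeasurable (f n) μ) {B : ℝ} (hB : ∀ n, ∀ᵐ ω ∂μ, |f n ω| ≤ B) :
    UniformIntegrable f 1 μ := by
  refine uniformIntegrable_of le_rfl ENNReal.one_ne_top hf fun ε _ ↦ ⟨(|B| + 1).toNNReal, fun n ↦ ?_⟩
  have hae : {x | (|B| + 1).toNNReal ≤ ‖f n x‖₊}.indicator (f n) =ᵐ[μ] 0 := by
    filter_upwards [hB n] with ω hω
    rw [indicator_of_notMem]
    · rfl
    · simp only [mem_setOf_eq, not_le]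
      rw [← NNReal.coe_lt_coe, coe_nnnorm, Real.norm_eq_abs, Real.coe_toNNReal _ (by positivity)]
      linarith [le_abs_self B]
  rw [eLpNorm_congr_ae hae, eLpNorm_zero]
  exact zero_le

/-! ### The level-`n` approximations are a.e. martingales -/

section LevelN

variable {A : Set ℂ} {hA : IsStarHull A} {δ : ℝ} {hδ : 0 < δ} {H : (ℝ≥0 → ℝ) → WithTop ℝ≥0}

/-- **The piece increments are a.e. martingales** (optional stopping of the continuous martingale
`pieceMart` at `ρ_s ≤ σ_s`). [cite: LawlerSchrammWerner2001, Thm. 2.2] -/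
theorem isAEMartingale_pieceIncr (hH : IsStoppingTime brownianFiltration H) {s : Finset (Set ℂ)}
    (hs : s ⊆ clusterFinset hA hδ) (n : ℕ) : IsAEMartingale (pieceIncr 6 hA hδ H s n) brownianFiltration preWienerMeasure := by
  haveI := isProbabilityMeasure_preWienerMeasure'
  have hM := martingale_pieceMart hs n
  have hc : ∀ᵐ ω ∂preWienerMeasure, Continuous fun t ↦ pieceMart 6 hA hδ s n t ω := ae_of_all _ (continuous_pieceMart hs n)
  exact (hM.isAEMartingale_stoppedProcess hc (isStoppingTime_thrSigma hH s).isOptionalTime).sub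
    (hM.isAEMartingale_stoppedProcess hc (isStoppingTime_thrRho hH hs).isOptionalTime)

/-- **The level-`n` sum is an a.e. martingale.** [cite: LawlerSchrammWerner2001, Thm. 2.2] -/
theorem isAEMartingale_thrLevelSum (hH : IsStoppingTime brownianFiltration H) (n : ℕ) :
    IsAEMartingale (thrLevelSum 6 hA hδ H n) brownianFiltration preWienerMeasure :=
  IsAEMartingale.finset_sum fun _ hs ↦ isAEMartingale_pieceIncr hH (Finset.mem_powerset.1 hs) n

/-- The level-`n` sum read at the start of a piece is `𝓕_{ρ_s}`-measurable. [folklore] -/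
theorem measurable_stoppedValue_thrLevelSum (hH : IsStoppingTime brownianFiltration H) (hHt : ∀ ω, H ω ≠ ⊤)
    {s : Finset (Set ℂ)} (hs : s ⊆ clusterFinset hA hδ) (n : ℕ) {κ : ℝ≥0} :
    Measurable[(isStoppingTime_thrRho (κ := κ) hH hs).measurableSpace]
      (stoppedValue (thrLevelSum κ hA hδ H n) (thrRho κ hA hδ H s)) := by
  have hρ := isStoppingTime_thrRho (κ := κ) (hA := hA) (hδ := hδ) hH hs
  have hfin : ∀ ω, thrRho κ hA hδ H s ω ≠ ⊤ := fun ω ↦ ne_top_of_le_ne_top (hHt ω) (thrRho_le s ω)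
  have heq : stoppedValue (thrLevelSum κ hA hδ H n) (thrRho κ hA hδ H s) = fun ω ↦
      ∑ s' ∈ (clusterFinset hA hδ).powerset,
        (stoppedValue (pieceMart κ hA hδ s' n) (fun ω ↦ min (thrRho κ hA hδ H s ω) (thrSigma κ hA hδ H s' ω)) ω -
          stoppedValue (pieceMart κ hA hδ s' n) (fun ω ↦ min (thrRho κ hA hδ H s ω) (thrRho κ hA hδ H s' ω)) ω) := by
    funext ω
    rw [stoppedValue, thrLevelSum]
    refine Finset.sum_congr rfl fun s' _ ↦ ?_
    rw [pieceIncr, ← stoppedValue_stoppedProcess_apply (hfin ω), ← stoppedValue_stoppedProcess_apply (hfin ω)]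
    rfl
  rw [heq]
  refine Finset.measurable_sum _ fun s' hs' ↦ ?_
  have hs'' := Finset.mem_powerset.1 hs'
  have hprog := isStronglyProgressive_pieceMart (κ := κ) hs'' n
  refine Measurable.sub ?_ ?_
  · exact (measurable_stoppedValue hprog (hρ.min (isStoppingTime_thrSigma hH s'))).mono
      (IsStoppingTime.measurableSpace_mono _ hρ fun ω ↦ min_le_left _ _) le_rfl
  · exact (measurable_stoppedValue hprog (hρ.min (isStoppingTime_thrRho hH hs''))).mono
      (IsStoppingTime.measurableSpace_mono _ hρ fun ω ↦ min_le_left _ _) le_rfl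

/-- **The bound of the piece martingales stopped before the horizon**: with
`K = (N+1) + 1160 (3(N+1) + 13 √T₀ + R)`, `|M^{s,n}_{t ∧ τ}| ≤ K` for every random time `τ ≤ H`
(`H ≤ capTimeK 6 N`, `H ≤ T₀`, `A ⊆ B̄(0, R)`). [folklore] -/
theorem abs_stoppedProcess_pieceMart_le {κ : ℝ≥0} {N : ℕ} {T₀ : ℝ≥0} (hHcap : ∀ ω, H ω ≤ capTimeK κ N ω)
    (hHT : ∀ ω, H ω ≤ (T₀ : WithTop ℝ≥0)) {s : Finset (Set ℂ)} (hs : s ⊆ clusterFinset hA hδ) {R : ℝ} (hR0 : 0 < R)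
    (hAR : A ⊆ closedBall (0 : ℂ) R) (n : ℕ) (t : ℝ≥0) {τ : (ℝ≥0 → ℝ) → WithTop ℝ≥0} {ω : ℝ≥0 → ℝ} (hτ : τ ω ≤ H ω) :
    |stoppedProcess (pieceMart κ hA hδ s n) τ t ω| ≤ ((N : ℝ) + 1) + 1160 * (3 * ((N : ℝ) + 1) + 13 * Real.sqrt T₀ + R) := by
  rw [stoppedProcess]
  set v : ℝ≥0 := (min (t : WithTop ℝ≥0) (τ ω)).untopA
  have hv : (v : WithTop ℝ≥0) ≤ H ω := (Literature.Analysis.FunctionSpaces.coe_untopA_min_le t (τ ω)).trans hτ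
  have hvT : (v : ℝ) ≤ T₀ := by have := hv.trans (hHT ω); exact_mod_cast (WithTop.coe_le_coe.1 this)
  have h := abs_pieceMart_le (κ := κ) hs hR0 hAR n (hv.trans (hHcap ω))
  have hsq : Real.sqrt (v : ℝ) ≤ Real.sqrt T₀ := Real.sqrt_le_sqrt hvT
  nlinarith [h, hsq]

/-- The piece clocks stopped before the horizon lie in `[0, T₀]`. [folklore] -/
theorem stoppedProcess_pieceClock_mem {κ : ℝ≥0} {T₀ : ℝ≥0} (hHT : ∀ ω, H ω ≤ (T₀ : WithTop ℝ≥0)) {s : Finset (Set ℂ)}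
    (hs : s ⊆ clusterFinset hA hδ) (n : ℕ) (t : ℝ≥0) {τ : (ℝ≥0 → ℝ) → WithTop ℝ≥0} {ω : ℝ≥0 → ℝ} (hτ : τ ω ≤ H ω) :
    stoppedProcess (pieceClock κ hA hδ s n) τ t ω ∈ Icc (0 : ℝ) T₀ := by
  rw [stoppedProcess]
  set v : ℝ≥0 := (min (t : WithTop ℝ≥0) (τ ω)).untopA
  have hv : (v : WithTop ℝ≥0) ≤ H ω := (Literature.Analysis.FunctionSpaces.coe_untopA_min_le t (τ ω)).trans hτ
  have hvT : (v : ℝ) ≤ T₀ := by have := hv.trans (hHT ω); exact_mod_cast (WithTop.coe_le_coe.1 this)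
  have h := pieceClock_mem_Icc (κ := κ) hs n v ω
  exact ⟨h.1, h.2.trans hvT⟩

variable {N : ℕ} {T₀ : ℝ≥0} {R : ℝ}

/-- **Uniform bound of the level-`n` sums**: `|U^n_{t ∧ τ}| ≤ 2^{#𝒬} · 2K` for `τ ≤ H`. [folklore] -/
theorem abs_thrLevelSum_le {κ : ℝ≥0} (hHcap : ∀ ω, H ω ≤ capTimeK κ N ω) (hHT : ∀ ω, H ω ≤ (T₀ : WithTop ℝ≥0))
    (hR0 : 0 < R) (hAR : A ⊆ closedBall (0 : ℂ) R) (n : ℕ) (t : ℝ≥0) (ω : ℝ≥0 → ℝ) :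
    |thrLevelSum κ hA hδ H n t ω| ≤ (clusterFinset hA hδ).powerset.card *
      (2 * (((N : ℝ) + 1) + 1160 * (3 * ((N : ℝ) + 1) + 13 * Real.sqrt T₀ + R))) := by
  rw [thrLevelSum]
  refine (Finset.abs_sum_le_sum_abs _ _).trans ?_
  rw [← nsmul_eq_mul, ← Finset.sum_const]
  refine Finset.sum_le_sum fun s hs ↦ ?_
  have hs' := Finset.mem_powerset.1 hs
  rw [pieceIncr]
  refine (abs_sub _ _).trans ?_
  have h1 := abs_stoppedProcess_pieceMart_le hHcap hHT hs' hR0 hAR n t (thrSigma_le (κ := κ) (hA := hA) (hδ := hδ) (H := H) s ω)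
  have h2 := abs_stoppedProcess_pieceMart_le hHcap hHT hs' hR0 hAR n t (thrRho_le (κ := κ) (hA := hA) (hδ := hδ) (H := H) s ω)
  linarith

/-- **The level-`n` compensated square is an a.e. martingale**: each summand is
`(R^{σ_s}_t − R^{ρ_s}_t) + ξ_s (M^{σ_s}_t − M^{ρ_s}_t)` with `R = (M^{s,n})² − 6 · pieceClock` a continuous
martingale and `ξ_s = 2 U^n_{ρ_s} − 2 M^{s,n}_{ρ_s}` bounded and `𝓕_{ρ_s}`-measurable
(`isAEMartingale_mul_stoppedProcess_sub`). [cite: LawlerSchrammWerner2001, Thm. 2.2] -/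
theorem isAEMartingale_thrLevelBracket (hH : IsStoppingTime brownianFiltration H) (hHcap : ∀ ω, H ω ≤ capTimeK 6 N ω)
    (hHT : ∀ ω, H ω ≤ (T₀ : WithTop ℝ≥0)) (hR0 : 0 < R) (hAR : A ⊆ closedBall (0 : ℂ) R) (n : ℕ) :
    IsAEMartingale (thrLevelBracket 6 hA hδ H n) brownianFiltration preWienerMeasure := by
  haveI := isProbabilityMeasure_preWienerMeasure'
  have hHt : ∀ ω, H ω ≠ ⊤ := fun ω ↦ ne_top_of_le_ne_top WithTop.coe_ne_top (hHT ω)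
  set K : ℝ := ((N : ℝ) + 1) + 1160 * (3 * ((N : ℝ) + 1) + 13 * Real.sqrt T₀ + R) with hK
  set Pw := (clusterFinset hA hδ).powerset with hPw
  refine IsAEMartingale.finset_sum fun s hs ↦ ?_
  have hs' := Finset.mem_powerset.1 hs
  have hρ := isStoppingTime_thrRho (κ := 6) (hA := hA) (hδ := hδ) hH hs'
  have hσ := isStoppingTime_thrSigma (κ := 6) (hA := hA) (hδ := hδ) hH s
  set M := pieceMart 6 hA hδ s n with hMdef
  set Cl := pieceClock 6 hA hδ s n with hCldef
  set Rp : ℝ≥0 → (ℝ≥0 → ℝ) → ℝ := fun t ω ↦ M t ω ^ 2 - 6 * Cl t ω with hRp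
  set ξ : (ℝ≥0 → ℝ) → ℝ := fun ω ↦ 2 * stoppedValue (thrLevelSum 6 hA hδ H n) (thrRho 6 hA hδ H s) ω -
    2 * stoppedValue M (thrRho 6 hA hδ H s) ω with hξ
  -- the algebraic identity
  have hiden : ∀ t ω, pieceIncr 6 hA hδ H s n t ω ^ 2 - 6 * pieceClockIncr 6 hA hδ H s n t ω +
      2 * stoppedValue (thrLevelSum 6 hA hδ H n) (thrRho 6 hA hδ H s) ω * pieceIncr 6 hA hδ H s n t ω =
      (stoppedProcess Rp (thrSigma 6 hA hδ H s) t ω - stoppedProcess Rp (thrRho 6 hA hδ H s) t ω) +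
        ξ ω * (stoppedProcess M (thrSigma 6 hA hδ H s) t ω - stoppedProcess M (thrRho 6 hA hδ H s) t ω) := by
    intro t ω
    rcases le_or_gt (t : WithTop ℝ≥0) (thrRho 6 hA hδ H s ω) with htρ | hρt
    · have htσ : (t : WithTop ℝ≥0) ≤ thrSigma 6 hA hδ H s ω := htρ.trans (thrRho_le_thrSigma s ω)
      simp only [pieceIncr, pieceClockIncr, stoppedProcess_eq_of_le htρ, stoppedProcess_eq_of_le htσ, sub_self, ← hMdef]
      ring
    · have h1 : stoppedProcess M (thrRho 6 hA hδ H s) t ω = stoppedValue M (thrRho 6 hA hδ H s) ω := by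
        rw [stoppedProcess_eq_of_ge hρt.le, stoppedValue]
      simp only [pieceIncr, pieceClockIncr, hξ, hRp, stoppedProcess, ← hMdef, ← hCldef] at h1 ⊢
      rw [h1]
      ring
  have hfun : (fun t ω ↦ pieceIncr 6 hA hδ H s n t ω ^ 2 - 6 * pieceClockIncr 6 hA hδ H s n t ω +
      2 * stoppedValue (thrLevelSum 6 hA hδ H n) (thrRho 6 hA hδ H s) ω * pieceIncr 6 hA hδ H s n t ω) =
      fun t ω ↦ (stoppedProcess Rp (thrSigma 6 hA hδ H s) t ω - stoppedProcess Rp (thrRho 6 hA hδ H s) t ω) +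
        ξ ω * (stoppedProcess M (thrSigma 6 hA hδ H s) t ω - stoppedProcess M (thrRho 6 hA hδ H s) t ω) := by
    funext t ω; exact hiden t ω
  rw [hfun]
  -- the two martingales and their continuity
  have hM : Martingale M brownianFiltration preWienerMeasure := martingale_pieceMart hs' n
  have hMc : ∀ᵐ ω ∂preWienerMeasure, Continuous fun t ↦ M t ω := ae_of_all _ (continuous_pieceMart hs' n)
  have hR : Martingale Rp brownianFiltration preWienerMeasure := martingale_pieceMart_sq_sub hs' n
  have hRc : ∀ᵐ ω ∂preWienerMeasure, Continuous fun t ↦ Rp t ω := ae_of_all _ fun ω ↦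
    ((continuous_pieceMart hs' n ω).pow 2).sub (continuous_const.mul ((pieceClock_spec (κ := 6) hs' n).2.1 ω))
  have hA1 : IsAEMartingale (fun t ω ↦ stoppedProcess Rp (thrSigma 6 hA hδ H s) t ω - stoppedProcess Rp (thrRho 6 hA hδ H s) t ω)
      brownianFiltration preWienerMeasure :=
    (hR.isAEMartingale_stoppedProcess hRc hσ.isOptionalTime).sub (hR.isAEMartingale_stoppedProcess hRc hρ.isOptionalTime)
  -- the weight
  have hξm : Measurable[hρ.measurableSpace] ξ :=
    ((measurable_stoppedValue_thrLevelSum hH hHt hs' n).const_mul 2).sub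
      ((measurable_stoppedValue (isStronglyProgressive_pieceMart hs' n) hρ).const_mul 2)
  have hξb : ∀ ω, |ξ ω| ≤ 2 * (Pw.card * (2 * K)) + 2 * K := fun ω ↦ by
    have h1 : |stoppedValue (thrLevelSum 6 hA hδ H n) (thrRho 6 hA hδ H s) ω| ≤ Pw.card * (2 * K) :=
      abs_thrLevelSum_le hHcap hHT hR0 hAR n _ ω
    have h2 : |stoppedValue M (thrRho 6 hA hδ H s) ω| ≤ K := by
      have := abs_stoppedProcess_pieceMart_le (κ := 6) hHcap hHT hs' hR0 hAR n ((thrRho 6 hA hδ H s ω).untopA)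
        (τ := thrRho 6 hA hδ H s) (ω := ω) (thrRho_le s ω)
      rwa [stoppedProcess, min_eq_right (by rw [WithTop.untopA_eq_untop (ne_top_of_le_ne_top (hHt ω) (thrRho_le s ω)),
        WithTop.coe_untop])] at this
    rw [hξ]
    calc _ ≤ |2 * stoppedValue (thrLevelSum 6 hA hδ H n) (thrRho 6 hA hδ H s) ω| + |2 * stoppedValue M (thrRho 6 hA hδ H s) ω| :=
          abs_sub _ _
      _ ≤ _ := by rw [abs_mul, abs_mul, abs_two]; gcongr
  have hA2 := isAEMartingale_mul_stoppedProcess_sub hM hMc hρ hσ (thrRho_le_thrSigma (κ := 6) (hA := hA) (hδ := hδ) (H := H) s) hξm hξb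
  exact hA1.add hA2

/-- **Uniform bound of the level-`n` compensated squares.** [folklore] -/
theorem abs_thrLevelBracket_le (hHcap : ∀ ω, H ω ≤ capTimeK 6 N ω) (hHT : ∀ ω, H ω ≤ (T₀ : WithTop ℝ≥0))
    (hR0 : 0 < R) (hAR : A ⊆ closedBall (0 : ℂ) R) (n : ℕ) (t : ℝ≥0) (ω : ℝ≥0 → ℝ) :
    |thrLevelBracket 6 hA hδ H n t ω| ≤ (clusterFinset hA hδ).powerset.card *
      ((2 * (((N : ℝ) + 1) + 1160 * (3 * ((N : ℝ) + 1) + 13 * Real.sqrt T₀ + R))) ^ 2 + 6 * T₀ +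
        2 * ((clusterFinset hA hδ).powerset.card * (2 * (((N : ℝ) + 1) + 1160 * (3 * ((N : ℝ) + 1) + 13 * Real.sqrt T₀ + R)))) *
          (2 * (((N : ℝ) + 1) + 1160 * (3 * ((N : ℝ) + 1) + 13 * Real.sqrt T₀ + R)))) := by
  set K : ℝ := ((N : ℝ) + 1) + 1160 * (3 * ((N : ℝ) + 1) + 13 * Real.sqrt T₀ + R) with hK
  set Pw := (clusterFinset hA hδ).powerset with hPw
  rw [thrLevelBracket]
  refine (Finset.abs_sum_le_sum_abs _ _).trans ?_
  rw [← nsmul_eq_mul, ← Finset.sum_const]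
  refine Finset.sum_le_sum fun s hs ↦ ?_
  have hs' := Finset.mem_powerset.1 hs
  have hG : |pieceIncr 6 hA hδ H s n t ω| ≤ 2 * K := by
    rw [pieceIncr]
    refine (abs_sub _ _).trans ?_
    have h1 := abs_stoppedProcess_pieceMart_le hHcap hHT hs' hR0 hAR n t (thrSigma_le (κ := 6) (hA := hA) (hδ := hδ) (H := H) s ω)
    have h2 := abs_stoppedProcess_pieceMart_le hHcap hHT hs' hR0 hAR n t (thrRho_le (κ := 6) (hA := hA) (hδ := hδ) (H := H) s ω)
    linarith
  have hC : |pieceClockIncr 6 hA hδ H s n t ω| ≤ T₀ := by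
    rw [pieceClockIncr]
    have h1 := stoppedProcess_pieceClock_mem (κ := 6) hHT hs' n t (thrSigma_le (κ := 6) (hA := hA) (hδ := hδ) (H := H) s ω)
    have h2 := stoppedProcess_pieceClock_mem (κ := 6) hHT hs' n t (thrRho_le (κ := 6) (hA := hA) (hδ := hδ) (H := H) s ω)
    rw [abs_le]; constructor <;> linarith [h1.1, h1.2, h2.1, h2.2]
  have hU : |stoppedValue (thrLevelSum 6 hA hδ H n) (thrRho 6 hA hδ H s) ω| ≤ Pw.card * (2 * K) :=
    abs_thrLevelSum_le hHcap hHT hR0 hAR n _ ω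
  have hK0 : 0 ≤ 2 * K := by positivity
  calc _ ≤ |pieceIncr 6 hA hδ H s n t ω ^ 2 - 6 * pieceClockIncr 6 hA hδ H s n t ω| +
        |2 * stoppedValue (thrLevelSum 6 hA hδ H n) (thrRho 6 hA hδ H s) ω * pieceIncr 6 hA hδ H s n t ω| := abs_add_le _ _
    _ ≤ (|pieceIncr 6 hA hδ H s n t ω ^ 2| + |6 * pieceClockIncr 6 hA hδ H s n t ω|) +
        |2 * stoppedValue (thrLevelSum 6 hA hδ H n) (thrRho 6 hA hδ H s) ω * pieceIncr 6 hA hδ H s n t ω| := by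
        gcongr; exact abs_sub _ _
    _ ≤ (2 * K) ^ 2 + 6 * T₀ + 2 * (Pw.card * (2 * K)) * (2 * K) := by
        rw [abs_pow, abs_mul, abs_mul, abs_mul, abs_two, show |(6 : ℝ)| = 6 by norm_num]
        gcongr

end LevelN

end Literature.Probability.RandomPlanarGeometry

end
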